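import Summits.Ventures.LatticeQCDFlow.Scoring.U1PlaquetteCharFunBounds
import HarnessLib

/-!
# The characteristic function of one plaquette angle in the Gaussian window: `|φ_β(t)| ≤ 1 − κ t²/β` for `|t| ≤ 2√β`

HONEST FRAMING: exact (Metropolis-corrected) sampling algorithms for lattice gauge theory;
figures of merit are autocorrelation/cost numbers at stated couplings and volumes; no
continuum-physics claim.

Venture `LatticeQCDFlow` (cell pub-lqcd), sub-topic `Scoring`; FANOUT row 5 (`s0-sun-a`), GEN-15.
NEW WORK of the cell (placement rule).  With `φ_β(t) = C_β(t)/Z(β)`,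
`C_β(t) = ∫_{−π}^{π} cos(tv) e^{β cos v} dv`, `Z(β) = ∫_{−π}^{π} e^{β cos v} dv`
(`Scoring/U1PlaquetteCharFunBounds.lean`), this file proves the uniform strict bound away from `1`
on the whole central window that a local limit theorem needs:

* `integral_cos_mul_mul_exp_le_window` — `C_β(t) ≤ Z(β) − (2t²/π²) ∫_{−a}^{a} v² e^{β cos v} dv`
  with `a = π/(2√β)`, for `β ≥ 1`, `|t| ≤ 2√β` (split `[−π, π]` at `±a`; on the window `|tv| ≤ π`
  and `cos(tv) ≤ 1 − 2t²v²/π²`, outside `cos ≤ 1`);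
* **`charFun_le_window`** — `φ_β(t) ≤ 1 − κ t²/β`, **`κ = √2 (2/3 − π²/20)/(4√π)`** (`≥ 1/30`,
  `kappa_ge`), from the window second moment `≥ e^β a³ (2/3 − π²/20)` and `Z ≤ e^β √(π³/(2β))`;
* **`neg_charFun_le_window`** — `−φ_β(t) ≤ 1 − (23/16) √2/(π√π)` (`1 + cos(tv) ≥ 3/2` on
  `|v| ≤ 1/(2√β)`), and `(23/16) √2/(π√π) ≥ 4κ`;
* **`abs_charFun_le_window`** — `|φ_β(t)| ≤ 1 − κ t²/β` for `β ≥ 1`, `|t| ≤ 2√β`; hence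
  **`abs_charFun_pow_le_window`** — `|φ_β(t)|^V ≤ exp(−κ V t²/β)`, and on the complement
  **`abs_charFun_pow_le_tail`** — `|φ_β(t)|^V ≤ (36/25)(β/t²)(3/5)^{V−2}` for `|t| ≥ 2√β`, `V ≥ 2`.

Elementary; nothing is cited.  No sampler values.
-/

noncomputable section

open Real MeasureTheory Set Filter Topology intervalIntegral
open Literature.Analysis.FunctionSpaces

namespace Summit.Ventures.LatticeQCDFlow.Scoring

/-! ### 1. Splitting the period at the window `[−a, a]`, `a = π/(2√β)` -/

/-- **Window comparison**: for `β ≥ 1` and `|t| ≤ 2√β`, with `a = π/(2√β)`,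
`C_β(t) ≤ Z(β) − (2t²/π²) ∫_{−a}^{a} v² e^{β cos v} dv`. -/
theorem integral_cos_mul_mul_exp_le_window {β : ℝ} (hβ : 1 ≤ β) {t : ℝ} (ht : |t| ≤ 2 * Real.sqrt β) :
    ∫ v in (-π)..π, Real.cos (t * v) * Real.exp (β * Real.cos v) ≤
      (∫ v in (-π)..π, Real.exp (β * Real.cos v)) -
        2 * t ^ 2 / π ^ 2 * ∫ v in (-(π / (2 * Real.sqrt β)))..(π / (2 * Real.sqrt β)),
          v ^ 2 * Real.exp (β * Real.cos v) := by
  have hπ : 0 < π := Real.pi_pos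
  have hβ0 : 0 < β := by linarith
  have hs : 1 ≤ Real.sqrt β := Real.one_le_sqrt.2 hβ
  have hs0 : 0 < Real.sqrt β := by linarith
  set a := π / (2 * Real.sqrt β) with ha
  have ha0 : 0 < a := by positivity
  have haπ : a ≤ π := by
    rw [ha, div_le_iff₀ (by positivity)]; nlinarith
  set f : ℝ → ℝ := fun v => Real.cos (t * v) * Real.exp (β * Real.cos v) with hf
  set w : ℝ → ℝ := fun v => Real.exp (β * Real.cos v) with hw
  have hfc : Continuous f := by rw [hf]; fun_prop
  have hwc : Continuous w := by rw [hw]; fun_prop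
  have hfi : ∀ x y : ℝ, IntervalIntegrable f volume x y := fun x y => hfc.intervalIntegrable x y
  have hwi : ∀ x y : ℝ, IntervalIntegrable w volume x y := fun x y => hwc.intervalIntegrable x y
  -- split both integrals at `−a` and `a`
  have hCs : ∫ v in (-π)..π, f v = (∫ v in (-π)..(-a), f v) + ((∫ v in (-a)..a, f v) + ∫ v in a..π, f v) := by
    rw [intervalIntegral.integral_add_adjacent_intervals (hfi _ _) (hfi _ _),
      intervalIntegral.integral_add_adjacent_intervals (hfi _ _) (hfi _ _)]
  have hZs : ∫ v in (-π)..π, w v = (∫ v in (-π)..(-a), w v) + ((∫ v in (-a)..a, w v) + ∫ v in a..π, w v) := by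
    rw [intervalIntegral.integral_add_adjacent_intervals (hwi _ _) (hwi _ _),
      intervalIntegral.integral_add_adjacent_intervals (hwi _ _) (hwi _ _)]
  -- outside the window: `cos ≤ 1`
  have hout : ∀ x y : ℝ, x ≤ y → ∫ v in x..y, f v ≤ ∫ v in x..y, w v := fun x y hxy => by
    refine intervalIntegral.integral_mono_on hxy (hfi _ _) (hwi _ _) fun v _ => ?_
    rw [hf, hw]
    exact mul_le_of_le_one_left (Real.exp_pos _).le (Real.cos_le_one _)
  -- inside the window: `cos(tv) ≤ 1 − 2t²v²/π²`
  have hin : ∫ v in (-a)..a, f v ≤ (∫ v in (-a)..a, w v) -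
      2 * t ^ 2 / π ^ 2 * ∫ v in (-a)..a, v ^ 2 * Real.exp (β * Real.cos v) := by
    have hc2 : Continuous fun v => 2 * t ^ 2 / π ^ 2 * (v ^ 2 * Real.exp (β * Real.cos v)) := by fun_prop
    rw [← intervalIntegral.integral_const_mul, ← intervalIntegral.integral_sub (hwi _ _)
      (hc2.intervalIntegrable _ _)]
    refine intervalIntegral.integral_mono_on (by linarith) (hfi _ _)
      ((hwc.sub hc2).intervalIntegrable _ _) fun v hv => ?_
    rw [hf, hw]
    simp only
    have hva : |v| ≤ a := abs_le.2 ⟨hv.1, hv.2⟩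
    have htv : |t * v| ≤ π := by
      rw [abs_mul]
      calc |t| * |v| ≤ 2 * Real.sqrt β * a := mul_le_mul ht hva (abs_nonneg _) (by positivity)
        _ = π := by rw [ha]; field_simp
    have hcos := Real.cos_le_one_sub_mul_cos_sq htv
    have hwp := Real.exp_pos (β * Real.cos v)
    have e : (1 - 2 / π ^ 2 * (t * v) ^ 2) * Real.exp (β * Real.cos v) =
        Real.exp (β * Real.cos v) - 2 * t ^ 2 / π ^ 2 * (v ^ 2 * Real.exp (β * Real.cos v)) := by ring
    rw [← e]
    exact mul_le_mul_of_nonneg_right hcos hwp.le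
  have h1 := hout (-π) (-a) (by linarith)
  have h3 := hout a π haπ
  rw [hCs, hZs]
  linarith

/-! ### 2. The upper window bound -/

/-- **`φ_β(t) ≤ 1 − κ t²/β`** for `β ≥ 1`, `|t| ≤ 2√β`, with `κ = √2 (2/3 − π²/20)/(4√π)`. -/
theorem charFun_le_window {β : ℝ} (hβ : 1 ≤ β) {t : ℝ} (ht : |t| ≤ 2 * Real.sqrt β) :
    (∫ v in (-π)..π, Real.cos (t * v) * Real.exp (β * Real.cos v)) /
        (∫ v in (-π)..π, Real.exp (β * Real.cos v)) ≤
      1 - Real.sqrt 2 * (2 / 3 - π ^ 2 / 20) / (4 * Real.sqrt π) * t ^ 2 / β := by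
  have hπ : 0 < π := Real.pi_pos
  have hβ0 : 0 < β := by linarith
  have hs0 : 0 < Real.sqrt β := Real.sqrt_pos.2 hβ0
  have hZ := integral_exp_mul_cos_neg_pi_pi_pos β
  have hZle := integral_exp_mul_cos_neg_pi_pi_le hβ0
  set a := π / (2 * Real.sqrt β) with ha
  have ha0 : 0 ≤ a := by positivity
  have hC := integral_cos_mul_mul_exp_le_window hβ ht
  have hJ := integral_sq_mul_exp_window_ge hβ0.le ha0
  rw [← ha] at hC
  set Z := ∫ v in (-π)..π, Real.exp (β * Real.cos v) with hZd
  set J := ∫ v in (-a)..a, v ^ 2 * Real.exp (β * Real.cos v) with hJd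
  -- `βa² = π²/4`
  have hss : Real.sqrt β ^ 2 = β := Real.sq_sqrt hβ0.le
  have ha2 : β * a ^ 2 = π ^ 2 / 4 := by
    rw [ha, div_pow, mul_pow, hss]; field_simp; norm_num
  have hJ' : Real.exp β * (a ^ 3 * (2 / 3 - π ^ 2 / 20)) ≤ J := by
    have e : 2 * a ^ 3 / 3 - β * a ^ 5 / 5 = a ^ 3 * (2 / 3 - π ^ 2 / 20) := by
      have : β * a ^ 5 = (β * a ^ 2) * a ^ 3 := by ring
      rw [this, ha2]; ring
    rw [← e]; exact hJ
  have hc0 : 0 < 2 / 3 - π ^ 2 / 20 := by nlinarith [Real.pi_lt_d2, Real.pi_gt_three]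
  -- `φ ≤ 1 − (2t²/π²) J/Z`
  rw [div_le_iff₀ hZ]
  have step1 : ∫ v in (-π)..π, Real.cos (t * v) * Real.exp (β * Real.cos v) ≤ Z - 2 * t ^ 2 / π ^ 2 * J := hC
  -- `(2t²/π²) J ≥ κ t²/β · Z`
  have hsqπ : 0 < Real.sqrt π := Real.sqrt_pos.2 hπ
  have hsq2 : 0 < Real.sqrt 2 := Real.sqrt_pos.2 (by norm_num)
  have hπ3 : Real.sqrt (π ^ 3 / (2 * β)) = π * Real.sqrt π / (Real.sqrt 2 * Real.sqrt β) := by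
    rw [Real.sqrt_div' _ (by positivity), show (π : ℝ) ^ 3 = π ^ 2 * π by ring,
      Real.sqrt_mul (by positivity), Real.sqrt_sq hπ.le, Real.sqrt_mul (by norm_num)]
  rw [hπ3] at hZle
  have key : Real.sqrt 2 * (2 / 3 - π ^ 2 / 20) / (4 * Real.sqrt π) * t ^ 2 / β * Z ≤
      2 * t ^ 2 / π ^ 2 * J := by
    -- replace `Z` by its upper bound and `J` by its lower bound
    have hκ0 : 0 ≤ Real.sqrt 2 * (2 / 3 - π ^ 2 / 20) / (4 * Real.sqrt π) * t ^ 2 / β := by positivity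
    calc Real.sqrt 2 * (2 / 3 - π ^ 2 / 20) / (4 * Real.sqrt π) * t ^ 2 / β * Z
        ≤ Real.sqrt 2 * (2 / 3 - π ^ 2 / 20) / (4 * Real.sqrt π) * t ^ 2 / β *
            (Real.exp β * (π * Real.sqrt π / (Real.sqrt 2 * Real.sqrt β))) :=
          mul_le_mul_of_nonneg_left hZle hκ0
      _ = 2 * t ^ 2 / π ^ 2 * (Real.exp β * (a ^ 3 * (2 / 3 - π ^ 2 / 20))) := by
          rw [ha]
          field_simp
          rw [hss]
          ring
      _ ≤ 2 * t ^ 2 / π ^ 2 * J := mul_le_mul_of_nonneg_left hJ' (by positivity)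
  linarith

/-! ### 3. The lower window bound -/

/-- **`−φ_β(t) ≤ 1 − (23/16)·√2/(π√π)`** for `β ≥ 1`, `|t| ≤ 2√β` (`1 + cos(tv) ≥ 3/2` on
`|v| ≤ 1/(2√β)`, the window mass `≥ e^β (23/24)/√β... ` and `Z ≤ e^β π√π/(√2 √β)`). -/
theorem neg_charFun_le_window {β : ℝ} (hβ : 1 ≤ β) {t : ℝ} (ht : |t| ≤ 2 * Real.sqrt β) :
    -((∫ v in (-π)..π, Real.cos (t * v) * Real.exp (β * Real.cos v)) /
        (∫ v in (-π)..π, Real.exp (β * Real.cos v))) ≤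
      1 - 23 / 16 * Real.sqrt 2 / (π * Real.sqrt π) := by
  have hπ : 0 < π := Real.pi_pos
  have hβ0 : 0 < β := by linarith
  have hs : 1 ≤ Real.sqrt β := Real.one_le_sqrt.2 hβ
  have hs0 : 0 < Real.sqrt β := by linarith
  have hZ := integral_exp_mul_cos_neg_pi_pi_pos β
  have hZle := integral_exp_mul_cos_neg_pi_pi_le hβ0
  set b := 1 / (2 * Real.sqrt β) with hb
  have hb0 : 0 ≤ b := by positivity
  have hbπ : b ≤ π := by
    rw [hb, div_le_iff₀ (by positivity)]; nlinarith [Real.pi_gt_three]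
  set Z := ∫ v in (-π)..π, Real.exp (β * Real.cos v) with hZd
  -- `∫ (1 + cos(tv)) w ≥ (3/2) ∫_{−b}^{b} w`
  set g : ℝ → ℝ := fun v => (1 + Real.cos (t * v)) * Real.exp (β * Real.cos v) with hg
  have hgc : Continuous g := by rw [hg]; fun_prop
  have hg0 : ∀ v, 0 ≤ g v := fun v => by
    rw [hg]; exact mul_nonneg (by linarith [Real.neg_one_le_cos (t * v)]) (Real.exp_pos _).le
  have hG : ∫ v in (-π)..π, g v = Z + ∫ v in (-π)..π, Real.cos (t * v) * Real.exp (β * Real.cos v) := by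
    rw [hZd, ← intervalIntegral.integral_add]
    · refine intervalIntegral.integral_congr fun v _ => ?_
      rw [hg]; simp only; ring
    · exact (by fun_prop : Continuous fun v => Real.exp (β * Real.cos v)).intervalIntegrable _ _
    · exact (by fun_prop : Continuous fun v => Real.cos (t * v) * Real.exp (β * Real.cos v))
        |>.intervalIntegrable _ _
  have hsub : ∫ v in (-b)..b, g v ≤ ∫ v in (-π)..π, g v :=
    intervalIntegral.integral_mono_interval (by linarith) (by linarith) hbπ
      (Filter.Eventually.of_forall hg0) (hgc.intervalIntegrable _ _)
  have hwin : 3 / 2 * ∫ v in (-b)..b, Real.exp (β * Real.cos v) ≤ ∫ v in (-b)..b, g v := by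
    rw [← intervalIntegral.integral_const_mul]
    refine intervalIntegral.integral_mono_on (by linarith) ?_ (hgc.intervalIntegrable _ _) fun v hv => ?_
    · exact (by fun_prop : Continuous fun v => 3 / 2 * Real.exp (β * Real.cos v)).intervalIntegrable _ _
    · rw [hg]
      refine mul_le_mul_of_nonneg_right ?_ (Real.exp_pos _).le
      have hva : |v| ≤ b := abs_le.2 ⟨hv.1, hv.2⟩
      have htv : |t * v| ≤ 1 := by
        rw [abs_mul]
        calc |t| * |v| ≤ 2 * Real.sqrt β * b := mul_le_mul ht hva (abs_nonneg _) (by positivity)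
          _ = 1 := by rw [hb]; field_simp
      have h1 := Real.one_sub_sq_div_two_le_cos (x := t * v)
      have h2 : (t * v) ^ 2 ≤ 1 := by
        have := abs_le.1 htv
        nlinarith
      linarith
  have hmass := integral_exp_window_ge hβ0.le hb0
  -- `βb² = 1/4`
  have hss : Real.sqrt β ^ 2 = β := Real.sq_sqrt hβ0.le
  have hb2 : β * b ^ 2 = 1 / 4 := by rw [hb, div_pow, mul_pow, hss]; field_simp; norm_num
  have hmass' : Real.exp β * (23 / 12 * b) ≤ ∫ v in (-b)..b, Real.exp (β * Real.cos v) := by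
    have e : 2 * b - β * b ^ 3 / 3 = 23 / 12 * b := by
      have : β * b ^ 3 = (β * b ^ 2) * b := by ring
      rw [this, hb2]; ring
    rw [← e]; exact hmass
  -- assemble: `Z + C ≥ (3/2)(23/12) e^β b = (23/16) e^β/√β ≥ (23/16)√2/(π√π) · Z`
  have hπ3 : Real.sqrt (π ^ 3 / (2 * β)) = π * Real.sqrt π / (Real.sqrt 2 * Real.sqrt β) := by
    rw [Real.sqrt_div' _ (by positivity), show (π : ℝ) ^ 3 = π ^ 2 * π by ring,
      Real.sqrt_mul (by positivity), Real.sqrt_sq hπ.le, Real.sqrt_mul (by norm_num)]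
  rw [hπ3] at hZle
  have hsqπ : 0 < Real.sqrt π := Real.sqrt_pos.2 hπ
  have hsq2 : 0 < Real.sqrt 2 := Real.sqrt_pos.2 (by norm_num)
  have h22 : Real.sqrt 2 * Real.sqrt 2 = 2 := Real.mul_self_sqrt (by norm_num)
  have key : 23 / 16 * Real.sqrt 2 / (π * Real.sqrt π) * Z ≤ 3 / 2 * (Real.exp β * (23 / 12 * b)) := by
    calc 23 / 16 * Real.sqrt 2 / (π * Real.sqrt π) * Z
        ≤ 23 / 16 * Real.sqrt 2 / (π * Real.sqrt π) *
            (Real.exp β * (π * Real.sqrt π / (Real.sqrt 2 * Real.sqrt β))) :=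
          mul_le_mul_of_nonneg_left hZle (by positivity)
      _ = 3 / 2 * (Real.exp β * (23 / 12 * b)) := by
          rw [hb]
          field_simp
          ring
  rw [neg_le, le_div_iff₀ hZ]
  have : -(1 - 23 / 16 * Real.sqrt 2 / (π * Real.sqrt π)) * Z =
      23 / 16 * Real.sqrt 2 / (π * Real.sqrt π) * Z - Z := by ring
  rw [this]
  linarith

/-! ### 4. The two-sided window bound and its consequences -/

/-- `4κ ≤ (23/16) √2/(π√π)` (so the lower bound is the weaker constraint on `|t| ≤ 2√β`). -/
theorem four_mul_kappa_le :
    4 * (Real.sqrt 2 * (2 / 3 - π ^ 2 / 20) / (4 * Real.sqrt π)) ≤ 23 / 16 * Real.sqrt 2 / (π * Real.sqrt π) := by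
  have hπ : 0 < π := Real.pi_pos
  have hsqπ : 0 < Real.sqrt π := Real.sqrt_pos.2 hπ
  have hsq2 : 0 < Real.sqrt 2 := Real.sqrt_pos.2 (by norm_num)
  have h3 := Real.pi_gt_three
  have h4 := Real.pi_lt_four
  rw [show 4 * (Real.sqrt 2 * (2 / 3 - π ^ 2 / 20) / (4 * Real.sqrt π)) =
      Real.sqrt 2 * (2 / 3 - π ^ 2 / 20) / Real.sqrt π by field_simp,
    div_le_div_iff₀ hsqπ (by positivity)]
  -- `√2 (2/3 − π²/20) · π√π ≤ (23/16)√2 · √π`, i.e. `(2/3 − π²/20) π ≤ 23/16`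
  have hkey : (2 / 3 - π ^ 2 / 20) * π ≤ 23 / 16 := by nlinarith
  have := mul_le_mul_of_nonneg_left hkey (mul_pos hsq2 hsqπ).le
  nlinarith [this]

/-- **THE WINDOW BOUND: `|φ_β(t)| ≤ 1 − κ t²/β`** for `β ≥ 1`, `|t| ≤ 2√β`,
`κ = √2 (2/3 − π²/20)/(4√π)`. -/
theorem abs_charFun_le_window {β : ℝ} (hβ : 1 ≤ β) {t : ℝ} (ht : |t| ≤ 2 * Real.sqrt β) :
    |(∫ v in (-π)..π, Real.cos (t * v) * Real.exp (β * Real.cos v)) /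
        (∫ v in (-π)..π, Real.exp (β * Real.cos v))| ≤
      1 - Real.sqrt 2 * (2 / 3 - π ^ 2 / 20) / (4 * Real.sqrt π) * t ^ 2 / β := by
  have hβ0 : 0 < β := by linarith
  set κ := Real.sqrt 2 * (2 / 3 - π ^ 2 / 20) / (4 * Real.sqrt π) with hκ
  have hκ0 : 0 ≤ κ := by
    have hc0 : 0 < 2 / 3 - π ^ 2 / 20 := by nlinarith [Real.pi_lt_d2, Real.pi_gt_three]
    positivity
  rw [abs_le]
  refine ⟨?_, by simpa [hκ, mul_div_assoc] using charFun_le_window hβ ht⟩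
  -- lower: `−φ ≤ 1 − c₃ ≤ 1 − 4κ ≤ 1 − κt²/β`
  have h1 := neg_charFun_le_window hβ ht
  have h2 := four_mul_kappa_le
  have ht2 : t ^ 2 ≤ 4 * β := by
    have h := abs_le.1 ht
    have hs := Real.sq_sqrt hβ0.le
    nlinarith [sq_abs t, abs_nonneg t]
  have h3 : κ * t ^ 2 / β ≤ 4 * κ := by
    rw [div_le_iff₀ hβ0]; nlinarith
  rw [← hκ] at h2
  rw [neg_le]
  linarith

/-- **Powers in the window**: `|φ_β(t)|^V ≤ exp(−κ V t²/β)` for `β ≥ 1`, `|t| ≤ 2√β`, every `V`. -/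
theorem abs_charFun_pow_le_window {β : ℝ} (hβ : 1 ≤ β) {t : ℝ} (ht : |t| ≤ 2 * Real.sqrt β) (V : ℕ) :
    |(∫ v in (-π)..π, Real.cos (t * v) * Real.exp (β * Real.cos v)) /
        (∫ v in (-π)..π, Real.exp (β * Real.cos v))| ^ V ≤
      Real.exp (-(Real.sqrt 2 * (2 / 3 - π ^ 2 / 20) / (4 * Real.sqrt π) * V * t ^ 2 / β)) := by
  have h := abs_charFun_le_window hβ ht
  set κ := Real.sqrt 2 * (2 / 3 - π ^ 2 / 20) / (4 * Real.sqrt π) with hκ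
  set x := κ * t ^ 2 / β with hx
  have h' : |(∫ v in (-π)..π, Real.cos (t * v) * Real.exp (β * Real.cos v)) /
      (∫ v in (-π)..π, Real.exp (β * Real.cos v))| ≤ 1 - x := by
    simpa [hx, hκ, mul_div_assoc] using h
  have hexp : 1 - x ≤ Real.exp (-x) := by linarith [Real.add_one_le_exp (-x)]
  calc _ ≤ (1 - x) ^ V := pow_le_pow_left₀ (abs_nonneg _) h' V
    _ ≤ Real.exp (-x) ^ V := pow_le_pow_left₀ (by linarith [abs_nonneg ((∫ v in (-π)..π,
        Real.cos (t * v) * Real.exp (β * Real.cos v)) / (∫ v in (-π)..π, Real.exp (β * Real.cos v)))])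
        hexp V
    _ = Real.exp (-(κ * V * t ^ 2 / β)) := by
        rw [← Real.exp_nat_mul, hx]; congr 1; ring

/-- **Powers in the tail**: `|φ_β(t)|^V ≤ (36/25)(β/t²)(3/5)^{V−2}` for `β ≥ 1`, `|t| ≥ 2√β`, `V ≥ 2`
(`|φ| ≤ (6/5)√β/|t| ≤ 3/5`). -/
theorem abs_charFun_pow_le_tail {β : ℝ} (hβ : 1 ≤ β) {t : ℝ} (ht : 2 * Real.sqrt β ≤ |t|) {V : ℕ}
    (hV : 2 ≤ V) :
    |(∫ v in (-π)..π, Real.cos (t * v) * Real.exp (β * Real.cos v)) /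
        (∫ v in (-π)..π, Real.exp (β * Real.cos v))| ^ V ≤
      36 / 25 * (β / t ^ 2) * (3 / 5) ^ (V - 2) := by
  have hβ0 : 0 < β := by linarith
  have hs : 1 ≤ Real.sqrt β := Real.one_le_sqrt.2 hβ
  have htpos : 0 < |t| := by linarith
  have ht0 : t ≠ 0 := abs_pos.1 htpos
  have h := abs_charFun_le_tail hβ ht0
  set r := |(∫ v in (-π)..π, Real.cos (t * v) * Real.exp (β * Real.cos v)) /
      (∫ v in (-π)..π, Real.exp (β * Real.cos v))| with hr
  have hr0 : 0 ≤ r := abs_nonneg _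
  have hr1 : r ≤ 6 / 5 * Real.sqrt β / |t| := h
  have hr2 : 6 / 5 * Real.sqrt β / |t| ≤ 3 / 5 := by
    rw [div_le_iff₀ htpos]; linarith
  obtain ⟨m, rfl⟩ := Nat.exists_eq_add_of_le' hV
  rw [show m + 2 - 2 = m from by omega, pow_add]
  have hsq : (6 / 5 * Real.sqrt β / |t|) ^ 2 = 36 / 25 * (β / t ^ 2) := by
    rw [div_pow, mul_pow, Real.sq_sqrt hβ0.le, sq_abs]; ring
  calc r ^ m * r ^ 2 ≤ (3 / 5) ^ m * (6 / 5 * Real.sqrt β / |t|) ^ 2 :=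
        mul_le_mul (pow_le_pow_left₀ hr0 (hr1.trans hr2) m) (pow_le_pow_left₀ hr0 hr1 2)
          (by positivity) (by positivity)
    _ = _ := by rw [hsq]; ring

/-- **`κ ≥ 1/30`** (`√2 ≥ 1.4142`, `π ≤ 3.1416`, `√π ≤ 1.7725`). -/
theorem kappa_ge : (1 : ℝ) / 30 ≤ Real.sqrt 2 * (2 / 3 - π ^ 2 / 20) / (4 * Real.sqrt π) := by
  have hπ : 0 < π := Real.pi_pos
  have hπ4 : π ≤ 3.1416 := Real.pi_lt_d4.le
  have hsqπ : Real.sqrt π ≤ 1.7725 := by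
    rw [Real.sqrt_le_left (by norm_num)]; nlinarith
  have hsqπ0 : 0 < Real.sqrt π := Real.sqrt_pos.2 hπ
  have hsq2 : (1.4142 : ℝ) ≤ Real.sqrt 2 := by
    rw [Real.le_sqrt (by norm_num) (by norm_num)]; norm_num
  have hc : (0.1731 : ℝ) ≤ 2 / 3 - π ^ 2 / 20 := by nlinarith
  rw [le_div_iff₀ (by positivity)]
  calc (1 : ℝ) / 30 * (4 * Real.sqrt π) ≤ 1 / 30 * (4 * 1.7725) := by gcongr
    _ ≤ 1.4142 * 0.1731 := by norm_num
    _ ≤ Real.sqrt 2 * (2 / 3 - π ^ 2 / 20) := mul_le_mul hsq2 hc (by norm_num) (by positivity)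

end Summit.Ventures.LatticeQCDFlow.Scoring
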